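import Literature.AlgebraicGeometry.ShimuraVarieties.UnitaryCurveSpecialPairReciprocity
import Literature.NumberTheory.ComplexMultiplication.ComplexReflexField
import HarnessLib

/-!
# Special-pair reciprocity on the unitary Shimura CURVE with the CENTRAL TORUS FACTOR EXPORTED — for every `σ` fixing the reflex
# compositum `E♯ = ι₁(F)·E*(Φ)` (all of `Aut(ℂ/ι₁F)` when `F/ℚ` is Galois), not only over a slice field
# ([Milne 2005] Def. 12.8 (60)–(62) at the special pair of [Deligne 1971] 5.11; [Shimura 1998] §18.6)

Topic `AlgebraicGeometry/ShimuraVarieties`; namespaces `Literature.AlgebraicGeometry.ShimuraVarieties.UnitaryCanonicalModel.Aux` (§1) and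
`…ShimuraVarieties.UnitaryCurve.AuxV` (§2).  THEOREMS ONLY (no definition, no named fact, no instance, no `sorry`; net Literature debt 0).
Cell `hodgecm-mathlib` (D-0151), FLOOR 0, P6 «MOD programme», X-leaf `stub_ESHEET` («the sheet line», E-pen A-p01 (g28) memo
`MEMO-ESHEET-organs.v1` 66df4d8c), organ **(S2a) «reciprocity with the CENTRAL twist»**, LA4-plan (g0) DEAL #26 → LA6-p02 (g2).
`--supports stmt-HodgeConjecture-24832`, count-neutral; HC_CM is proved only modulo the printed citations until rung 0 closes.

THE POINT.  ★ E3R-U `UnitaryCurve.AuxV.exists_sliceField_siegelRecipDatum_pinned` (ED. 3) produces, at a special point `[ι₁ w, a]` of the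
unitary Shimura curve and for `σ` fixing a SLICE FIELD `E₀ ⊇ C_𝔪(E♯)`, the Siegel reciprocity datum `(c, Φ′, E♯, s♯, r)` with `r·ũ_V(a,1) =
ũ_V(d♯·a,1)·t`, `t ∈ K_δ(N)`.  Its proof in fact establishes, for EVERY `σ` fixing only the reflex compositum `E♯ = ι₁(F)·E*(Φ)` ([Liu2021] Lem.
C.14) with `E♯`-correspondent `s♯` ([Milne2005ShimuraVarieties] (59)), the reciprocity element `r = ũ_V(d♯, t)` of [Milne2005ShimuraVarieties]
(62) with the CENTRAL TORUS COORDINATE `t = N_{E♯,Φ}(s♯) ∈ T₀(F)(𝔸_f)` (the reflex norm of the CM type `Φ ∋ ι₁` of the line `w^⊥`, ★ FILE B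
`coe_auxToGspFinV_eq_cmRecipMatrix_of_isDiagTwistGS`), the unitary twist `d♯ = r_w(N_{E♯/F} s♯)`, and the TYPE-NORM IDENTITY
`N_{E♯,Ψ}(s♯) = t · (N s♯)‾/(N s♯)` for the swapped type `Ψ = Φ ∖ {ι₁} ∪ {ῑ₁}` of the line `w` ([Shimura1998] §18.6 (2); ★
`reflexNormFiniteIdele_swap_recipFactor`); the slice field served ONLY to put `ũ_V(1,t)` inside `K_δ(N)`.  This file EXPORTS the torus factor:
* §1 `Aux.reflexField_le_fieldRange_of_isGalois`, `Aux.forall_mem_reflexField_apply_eq_of_isGalois` — for `F/ℚ` Galois `E♯ = ι₁(F)` (★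
  `ComplexReflexField.traceField_le_fieldRange`), so «`σ` fixes `E♯`» is «`σ ∈ Aut(ℂ/ι₁F)`».
* §2 HEAD `exists_siegelRecipDatum_centralTwist` — binders of ED. 3 VERBATIM (minus `N ≠ 0`, no level enters); conclusion for every
  `σ : ℂ ≃ₐ[ℚ] ℂ` fixing `E♯` pointwise: the pinned CM structure `c`, the types `Φ′ = (Φ, Ψ)`, the `E♯`-correspondent `s♯`, the torus element
  `t` and the twist `d♯` with: special pair, frame pin, `E*(Φ′ᵢ) ⊆ E♯`, `ũ_V(d♯,t)` of matrix `c.cmRecipMatrix Φ′ E♯ s♯`, `t = N_{E♯,Φ}(s♯)`, an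
  `F`-correspondent `s′ = N_{E♯/F}(s♯)` of `σ` with `d♯ = r_w(s′)`-twist and `N_{E♯,Ψ}(s♯) = t · (s̄′/s′)`, the SPLIT IDENTITY
  **`ũ_V(d♯,t) · ũ_V(a,1) = ũ_V(d♯·a,1) · ũ_V(1,t)`**, and `[ι₁w, d·a]_K = [ι₁w, d♯·a]_K` for every `K` (★ FILE D).
Consumers (memo §2): (S3) «`T′ = ψ_𝔞`» reads `σ • f[ι₁w, a]` through ★ E3R-S `smul_q_mk_eq_q_mk_cmRecip_of_forall_mem_apply_eq` at
`(c, J(ι₁w), Φ′, E♯, σ, s♯, ũ_V(d♯,t))` and this split identity; (S6)∕(S7) read the twist class off `t`.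

## References
* [Milne2005ShimuraVarieties] J. S. Milne, *Introduction to Shimura varieties* (2005), Def. 12.8 (59)–(62) p. 114, §11 Thm. 11.2 p. 108.
* [Deligne1971TravauxShimura] P. Deligne, *Travaux de Shimura* (1971), 4.18 p. 150, 5.11 p. 158.
* [Shimura1998] G. Shimura, *Abelian Varieties with Complex Multiplication and Modular Functions* (1998), §8.3 Prop. 28, §18.6 p. 128.
* [RapoportSmithlingZhang2020Diagonal] M. Rapoport, B. Smithling, W. Zhang, Compos. Math. 156 (2020), Remark 3.1, (3.3), (3.10).
* [Liu2021] Y. Liu, *Fourier–Jacobi cycles and arithmetic relative trace formula* (2021), App. C Lem. C.14 and Rem. C.15 (p. 113).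
-/

set_option autoImplicit false

noncomputable section

open Matrix NumberField IsDedekindDomain
open scoped TensorProduct

namespace Literature.AlgebraicGeometry.ShimuraVarieties

/-! ### §1. For `F/ℚ` Galois the reflex compositum is `ι₁(F)` -/

namespace UnitaryCanonicalModel

namespace Aux

open Literature.NumberTheory.ComplexMultiplication (traceField traceField_le_fieldRange)
open Literature.AlgebraicGeometry.Motives (CMType)

/-- **`E♯ = ι₁(F)·E*(Φ) ⊆ ι₁(F)` when `F/ℚ` is Galois**: the trace field of every CM type of `F` lies in the image of any complex
embedding of a Galois `F` (★ `traceField_le_fieldRange`, [Shimura1998] §8.3 Prop. 28), hence so does the compositum.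
[cite: Shimura1998, §8.3 Prop. 28] [cite: Liu2021, App. C Lem. C.14 (p. 113)] -/
theorem reflexField_le_fieldRange_of_isGalois (L : Type) [Field L] [NumberField L] [IsGalois ℚ L] (Φ : CMType L)
    (τ : L →+* ℂ) : reflexField L Φ τ ≤ τ.toRatAlgHom.fieldRange :=
  sup_le le_rfl (traceField_le_fieldRange (AlgHom.id ℚ L) τ Φ)

/-- For `F/ℚ` Galois, an automorphism of `ℂ` fixing `τ(F)` pointwise fixes the reflex compositum `E♯ = τ(F)·E*(Φ)` pointwise — so the
heads below, stated over `E♯`, apply to EVERY `σ ∈ Aut(ℂ/τF)`. [cite: Shimura1998, §8.3 Prop. 28] [cite: Liu2021, App. C Lem. C.14 (p. 113)] -/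
theorem forall_mem_reflexField_apply_eq_of_isGalois (L : Type) [Field L] [NumberField L] [IsGalois ℚ L] (Φ : CMType L)
    (τ : L →+* ℂ) (σ : ℂ ≃ₐ[ℚ] ℂ) (hσ : ∀ x : L, σ (τ x) = τ x) : ∀ x : ℂ, x ∈ reflexField L Φ τ → σ x = x := by
  intro x hx
  obtain ⟨y, rfl⟩ := reflexField_le_fieldRange_of_isGalois L Φ τ hx
  exact hσ y

end Aux

end UnitaryCanonicalModel

/-! ### §2. HEAD: the Siegel reciprocity datum of a special point of the curve over the reflex compositum, torus factor exported -/

namespace UnitaryCurve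

namespace AuxV

open Literature.AlgebraicGeometry.ModuliOfAbelianVarieties
open Literature.NumberTheory.ComplexMultiplication (traceField reflexNormFiniteIdele ratFiniteAdeleTensorEquiv)
open Literature.AlgebraicGeometry.Motives (CMType)
open Literature.NumberTheory.Automorphic Literature.NumberTheory.Automorphic.UnitaryGroup
open Literature.NumberTheory.AdelicBaseChange (finiteIdeleRelNorm)
open Literature.AlgebraicGeometry.ShimuraVarieties.UnitaryCanonicalModel (IsArtinCorrespondent recipFactor IsDiagTwistGS ShimuraSetGS
  exists_isDiagTwistGS_recipFactor' conj_apply_eq_of_transpose_map_eq hermForm_conj_symm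
  shimuraSetGS_mk_twist_eq_of_isArtinCorrespondent')
open Literature.AlgebraicGeometry.ShimuraVarieties.UnitaryCanonicalModel.Aux (torusFinAdelic reflexField numberField_reflexField
  toReflexField traceField_le_reflexField apply_mem_reflexField reflexNormFiniteIdele_mem_torusFinAdelic_of_le isTotallyComplex_reflexField
  artinSurjectiveReflex isArtinCorrespondent_finiteIdeleRelNorm exists_cmType_swap traceField_le_of_swap reflexNormFiniteIdele_swap_recipFactor
  finAdeleToTensor ratBasis)

variable {F : Type} [Field F] [NumberField F] [IsCMField F]

omit [NumberField F] [IsCMField F] in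
/-- The Gram entries of a frame: `(ᵗc(b)·J·b)_{ik} = ⟨b e_i, b e_k⟩_J`. [cite: Deligne1979ShimuraVarieties, 2.3.9 (PDF p. 32)] -/
private theorem transpose_map_mul_mul_apply' (c : F →+* F) (J b : Matrix (Fin 2) (Fin 2) F) (i k : Fin 2) :
    ((b.map c)ᵀ * J * b) i k = hermForm c J (fun l => b l i) (fun l => b l k) := by
  simp only [Matrix.mul_apply, Matrix.transpose_apply, Matrix.map_apply, hermForm, dotProduct, Matrix.mulVec,
    Function.comp_apply, Finset.sum_mul, Finset.mul_sum, mul_assoc]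
  rw [Finset.sum_comm]

/-- **E3R HEAD OVER THE REFLEX COMPOSITUM, CENTRAL TORUS FACTOR EXPORTED** (organ (S2a) of the sheet line).  Data as in ★ ED. 3
`exists_sliceField_siegelRecipDatum_pinned` (Hermitian `J⋆` on `F²`, `ι₁ ∈ Φ`, the symplectic frame `Fr`, a Hodge-embedding datum `J` landing in
`S^±`, and BY VALUE the special-pair property `hJsp` of E2's complex structure).  Conclusion, for EVERY `σ : ℂ ≃ₐ[ℚ] ℂ` fixing the reflex
compositum `E♯ = ι₁(F)·E*(Φ)` pointwise, every `F`-idèle `s` corresponding to `σ` along `ι₁`, every special `w` with unitary twist `d = r_w(s)`-diagonal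
and every adelic `a`: a CM structure `c` by `F × F` SPECIAL for `J(ι₁ w)` of types `Φ′ = (Φ, Ψ)`, `Ψ = Φ ∖ {ι₁} ∪ {ῑ₁}`, PINNED on the frame
(`c.actMatrix (x,x) = P_Fr·res(x•1)·Q_Fr`), with `E*(Φ′ᵢ) ⊆ E♯`; an `E♯`-idèle `s♯` corresponding to `σ`; the torus element `t = N_{E♯,Φ}(s♯) ∈ T₀(F)(𝔸_f)`;
a twist `d♯` — such that `ũ_V(d♯, t)` has matrix `c.cmRecipMatrix Φ′ E♯ s♯` (the reciprocity element of [Milne2005ShimuraVarieties] (62) at the CM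
point), `s′ := N_{E♯/F}(s♯)` corresponds to `σ` along `ι₁` with `d♯` an `r_w(s′)`-twist and the TYPE-NORM IDENTITY `N_{E♯,Ψ}(s♯) = t · (s̄′/s′)` (read
in `F ⊗ 𝔸_{ℚ,f}`), the SPLIT IDENTITY `ũ_V(d♯,t)·ũ_V(a,1) = ũ_V(d♯·a,1)·ũ_V(1,t)` holds in `GSp_δ(𝔸_f)`, and `[ι₁w, d·a]_K = [ι₁w, d♯·a]_K` for every
level `K` (★ FILE D).  Proof: the proof of ED. 3 with its §1 (conductor) and §2 (slice field) steps removed — the `E♯`-correspondent is ★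
`artinSurjectiveReflex` itself.  No level `N` enters.
[cite: Milne2005ShimuraVarieties, Def. 12.8 (59)–(62) p. 114, §11 Thm. 11.2 p. 108] [cite: Deligne1971TravauxShimura, 4.18 p. 150 and 5.11 p. 158]
[cite: Shimura1998, §18.6 p. 128] [cite: RapoportSmithlingZhang2020Diagonal, Remark 3.1 p. 9, (3.3), (3.10)] [cite: Liu2021, App. C Lem. C.14 (p. 113)] -/
theorem exists_siegelRecipDatum_centralTwist (ι₁ : F →+* ℂ) (Jstar : Matrix (Fin 2) (Fin 2) F)
    (hJ : (Jstar.map (IsCMField.complexConj F))ᵀ = Jstar) (Φ : CMType F) (hΦ : ι₁ ∈ Φ.1) {ξ : F} {g : ℕ} {δ : Fin g → ℕ}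
    (Fr : SymplecticFrameV F (RingHom.id F) Jstar ξ g δ)
    (J : (Fin 2 → ℂ) → Matrix (Fin g ⊕ Fin g) (Fin g ⊕ Fin g) ℝ)
    (hJC : ∀ v : Fin 2 → ℂ, v ∈ negCone (Jstar.map ι₁) → J v ∈ C0pm δ)
    (hJsp : ∀ (w : Fin 2 → F) (hw : (fun i => ι₁ (w i)) ∈ negCone (Jstar.map ι₁)) (b : GL (Fin 2) F),
      (fun i => (b : Matrix (Fin 2) (Fin 2) F) i 1) = w →
      hermForm (cmConjRingHom F) Jstar (fun i => (b : Matrix (Fin 2) (Fin 2) F) i 0) w = 0 →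
      ∀ c : CMStructure g δ (Fin 2) (fun _ => F),
        (∀ (x : Fin 2 → F) (p : Fin 2) (m : F),
          c.act x (Fr.β (m • (b : Matrix (Fin 2) (Fin 2) F) *ᵥ Pi.single p 1)) =
            Fr.β ((x p * m) • (b : Matrix (Fin 2) (Fin 2) F) *ᵥ Pi.single p 1)) →
        ∀ Φ' : Fin 2 → CMType F, Φ' 0 = Φ →
          (∀ ρ : F →+* ℂ, ρ ∈ (Φ' 1).1 ↔ (ρ ∈ Φ.1 ∧ ρ ≠ ι₁) ∨ ρ = NumberField.ComplexEmbedding.conjugate ι₁) →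
          c.IsSpecial ⟨J (fun i => ι₁ (w i)), hJC _ hw⟩ Φ') :
    haveI : NumberField ↥(reflexField F Φ ι₁) := numberField_reflexField F Φ ι₁
    ∀ σ : ℂ ≃ₐ[ℚ] ℂ, (∀ x : ℂ, x ∈ reflexField F Φ ι₁ → σ x = x) →
      ∀ s : (FiniteAdeleRing (𝓞 F) F)ˣ, IsArtinCorrespondent F ι₁ s σ.toRingEquiv →
      ∀ (w : Fin 2 → F) (hw : (fun i => ι₁ (w i)) ∈ negCone (Jstar.map ι₁))
        (d : ↥(finAdelic (↥(maximalRealSubfield F)) F (IsCMField.complexConj F) 2 Jstar)),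
        IsDiagTwistGS F Jstar w (recipFactor F s) d →
      ∀ a : ↥(finAdelic (↥(maximalRealSubfield F)) F (IsCMField.complexConj F) 2 Jstar),
        ∃ (c : CMStructure g δ (Fin 2) (fun _ => F)) (Φ' : Fin 2 → CMType F)
          (sE : (FiniteAdeleRing (𝓞 ↥(reflexField F Φ ι₁)) ↥(reflexField F Φ ι₁))ˣ) (t : ↥(torusFinAdelic F))
          (d' : ↥(finAdelic (↥(maximalRealSubfield F)) F (IsCMField.complexConj F) 2 Jstar)),
          c.IsSpecial ⟨J (fun i => ι₁ (w i)), hJC _ hw⟩ Φ' ∧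
          (∀ x : F, c.actMatrix (fun _ => x) = framePV Fr * resMatrix (ratBasis F) (x • (1 : Matrix (Fin 2) (Fin 2) F)) * frameQV Fr) ∧
          Φ' 0 = Φ ∧ (∀ ρ : F →+* ℂ, ρ ∈ (Φ' 1).1 ↔ (ρ ∈ Φ.1 ∧ ρ ≠ ι₁) ∨ ρ = NumberField.ComplexEmbedding.conjugate ι₁) ∧
          (∀ i, traceField (Φ' i) ≤ reflexField F Φ ι₁) ∧
          IsArtinCorrespondent ↥(reflexField F Φ ι₁) (algebraMap ↥(reflexField F Φ ι₁) ℂ) sE σ.toRingEquiv ∧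
          ((auxToGspFinV Fr (d', t) : GL (Fin g ⊕ Fin g) finAdeleQ) : Matrix (Fin g ⊕ Fin g) (Fin g ⊕ Fin g) finAdeleQ) =
            c.cmRecipMatrix Φ' (reflexField F Φ ι₁) sE ∧
          (t : (FiniteAdeleRing (𝓞 F) F)ˣ) = reflexNormFiniteIdele F Φ (reflexField F Φ ι₁) sE ∧
          (∃ s' : (FiniteAdeleRing (𝓞 F) F)ˣ, IsArtinCorrespondent F ι₁ s' σ.toRingEquiv ∧ IsDiagTwistGS F Jstar w (recipFactor F s') d' ∧
            ((reflexNormFiniteIdele F (Φ' 1) (reflexField F Φ ι₁) sE : (FiniteAdeleRing (𝓞 F) F)ˣ) : FiniteAdeleRing (𝓞 F) F) =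
              ((t : (FiniteAdeleRing (𝓞 F) F)ˣ) : FiniteAdeleRing (𝓞 F) F) *
                ratFiniteAdeleTensorEquiv F (finAdeleToTensor F (RingHom.id F) (recipFactor F s'))) ∧
          auxToGspFinV Fr (d', t) * auxToGspFinV Fr (a, 1) = auxToGspFinV Fr (d' * a, 1) * auxToGspFinV Fr (1, t) ∧
          ∀ K : Subgroup ↥(finAdelic (↥(maximalRealSubfield F)) F (IsCMField.complexConj F) 2 Jstar),
            ShimuraSetGS.mk F Jstar ι₁ K (fun i => ι₁ (w i)) hw (d * a) = ShimuraSetGS.mk F Jstar ι₁ K (fun i => ι₁ (w i)) hw (d' * a) := by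
  classical
  -- the reflex compositum `E♯ = ι₁(F)·E*(Φ)` and the swapped type `Ψ = Φ^ῑ₁`
  haveI : NumberField ↥(reflexField F Φ ι₁) := numberField_reflexField F Φ ι₁
  haveI : IsTotallyComplex ↥(reflexField F Φ ι₁) := isTotallyComplex_reflexField F Φ ι₁
  letI : Algebra F ↥(reflexField F Φ ι₁) := (toReflexField F Φ ι₁).toAlgebra
  have hEΦ : traceField Φ ≤ reflexField F Φ ι₁ := traceField_le_reflexField F Φ ι₁
  have hι₁ : NumberField.ComplexEmbedding.conjugate ι₁ ≠ ι₁ := fun h =>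
    NumberField.IsTotallyComplex.complexEmbedding_not_isReal ι₁ (NumberField.ComplexEmbedding.isReal_iff.mpr h)
  obtain ⟨Ψ, hΨ⟩ := exists_cmType_swap Φ ι₁ (RingHom.id F) hι₁
  have hΨE : traceField Ψ ≤ reflexField F Φ ι₁ :=
    traceField_le_of_swap Φ Ψ ι₁ (RingHom.id F) hΨ (reflexField F Φ ι₁) (apply_mem_reflexField F Φ ι₁) hEΦ
  have hJ' : ∀ i k, cmConjRingHom F (Jstar i k) = Jstar k i := conj_apply_eq_of_transpose_map_eq F Jstar hJ
  intro σ hσ s hs w hw d hd a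
  -- an Artin correspondent of `σ` over `E♯` (no slice field: `σ` fixes `E♯` by hypothesis), and its norm to `F`
  have hσE : ∀ x : ↥(reflexField F Φ ι₁), σ.toRingEquiv (algebraMap ↥(reflexField F Φ ι₁) ℂ x) =
      algebraMap ↥(reflexField F Φ ι₁) ℂ x := fun x => hσ _ x.2
  obtain ⟨u, hus⟩ := artinSurjectiveReflex F Φ ι₁ σ.toRingEquiv hσE
  have hNu : IsArtinCorrespondent F ι₁ (finiteIdeleRelNorm F ↥(reflexField F Φ ι₁) u) σ.toRingEquiv :=
    isArtinCorrespondent_finiteIdeleRelNorm F Φ ι₁ σ.toRingEquiv u hus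
  -- the twist `d♯` by `r_w(N u)` and the frame `b = (w′ | w)`
  have hww : hermForm (cmConjRingHom F) Jstar w w ≠ 0 :=
    UnitaryCanonicalModel.hermForm_self_ne_zero_of_embedding_mem_negCone hw
  obtain ⟨d', hd'⟩ := exists_isDiagTwistGS_recipFactor' F Jstar hJ hww (finiteIdeleRelNorm F ↥(reflexField F Φ ι₁) u)
  have hsymm : ∀ x y : Fin 2 → F, hermForm (cmConjRingHom F) Jstar x y = 0 → hermForm (cmConjRingHom F) Jstar y x = 0 := by
    intro x y hxy
    rw [hermForm_conj_symm F Jstar hJ', hxy, map_zero]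
  obtain ⟨-, b₀, -, hb1₀, hperp₀, -⟩ :=
    exists_frame_formCongr_eq_finSum_of_hermForm_self_ne_zero (cmConjRingHom F) (n := 1) Jstar hsymm w hww
  have key : ∃ b : GL (Fin 2) F, (fun i => (b : Matrix (Fin 2) (Fin 2) F) i 1) = w ∧
      hermForm (cmConjRingHom F) Jstar (fun i => (b : Matrix (Fin 2) (Fin 2) F) i 0) w = 0 :=
    ⟨b₀, funext fun i => hb1₀ i, hsymm _ _ (hperp₀ 0)⟩
  obtain ⟨b, hb1', hperp⟩ := key
  have hperp0 : hermForm (cmConjRingHom F) Jstar w (fun i => (b : Matrix (Fin 2) (Fin 2) F) i 0) = 0 := hsymm _ _ hperp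
  have hJid : Jstar.map (RingHom.id F) = Jstar := by
    ext i k
    rfl
  -- the CM structure of the frame (FILE A) and the special pair (E2, by value)
  have hB : ∀ i k : Fin 2, i ≠ k →
      (((b : Matrix (Fin 2) (Fin 2) F).map (IsCMField.complexConj F))ᵀ * Jstar.map (RingHom.id F) *
        (b : Matrix (Fin 2) (Fin 2) F)) i k = 0 := by
    intro i k hik
    rw [hJid]
    change (((b : Matrix (Fin 2) (Fin 2) F).map (cmConjRingHom F))ᵀ * Jstar * (b : Matrix (Fin 2) (Fin 2) F)) i k = 0
    rw [transpose_map_mul_mul_apply']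
    fin_cases i <;> fin_cases k
    · exact absurd rfl hik
    · change hermForm (cmConjRingHom F) Jstar (fun l => (b : Matrix (Fin 2) (Fin 2) F) l 0)
          (fun l => (b : Matrix (Fin 2) (Fin 2) F) l 1) = 0
      rw [hb1']; exact hperp
    · change hermForm (cmConjRingHom F) Jstar (fun l => (b : Matrix (Fin 2) (Fin 2) F) l 1)
          (fun l => (b : Matrix (Fin 2) (Fin 2) F) l 0) = 0
      rw [hb1']; exact hperp0
    · exact absurd rfl hik
  obtain ⟨c, hc⟩ := exists_cmStructureV_of_orthogonal Fr b hB
  let Φ' : Fin 2 → CMType F := ![Φ, Ψ]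
  have hΦ'0 : Φ' 0 = Φ := rfl
  have hΦ'1 : Φ' 1 = Ψ := rfl
  have hΨ' : ∀ ρ : F →+* ℂ, ρ ∈ (Φ' 1).1 ↔ (ρ ∈ Φ.1 ∧ ρ ≠ ι₁) ∨ ρ = NumberField.ComplexEmbedding.conjugate ι₁ := by
    intro ρ
    rw [hΦ'1, hΨ ρ, RingHom.comp_id]
  have hsp : c.IsSpecial ⟨J (fun i => ι₁ (w i)), hJC _ hw⟩ Φ' := hJsp w hw b hb1' hperp c hc Φ' hΦ'0 hΨ'
  -- the torus element `t = N_{E♯,Φ}(u)` and the reciprocity element `r = ũ_V(d♯, t)`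
  let t : ↥(torusFinAdelic F) :=
    ⟨reflexNormFiniteIdele F Φ (reflexField F Φ ι₁) u, reflexNormFiniteIdele_mem_torusFinAdelic_of_le F Φ (reflexField F Φ ι₁) hEΦ u⟩
  have hbmap : Matrix.GeneralLinearGroup.map (RingHom.id F) b = b := by
    ext i k
    rfl
  have hact : ∀ x : Fin 2 → F, c.actMatrix x =
      framePV Fr * resMatrix (ratBasis F)
        (((Matrix.GeneralLinearGroup.map (RingHom.id F) b : GL (Fin 2) F) : Matrix (Fin 2) (Fin 2) F) * Matrix.diagonal x *
          (((Matrix.GeneralLinearGroup.map (RingHom.id F) b)⁻¹ : GL (Fin 2) F) : Matrix (Fin 2) (Fin 2) F)) * frameQV Fr := by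
    intro x
    rw [hbmap]
    exact actMatrix_eq_frame_of_pinnedV Fr b c hc x
  -- the structure is PINNED on the frame: a constant tuple acts by the scalar `x • 1` read through `Fr`
  have hpin : ∀ x : F, c.actMatrix (fun _ => x) =
      framePV Fr * resMatrix (ratBasis F) (x • (1 : Matrix (Fin 2) (Fin 2) F)) * frameQV Fr := by
    intro x
    rw [hact]
    congr 2
    have hdiag : (Matrix.diagonal fun _ : Fin 2 => x) = x • (1 : Matrix (Fin 2) (Fin 2) F) := by
      ext i k
      by_cases hik : i = k
      · subst hik; simp
      · simp [Matrix.one_apply_ne hik, hik]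
    rw [hdiag, Matrix.mul_smul, Matrix.mul_one, Matrix.smul_mul, ← Units.val_mul, mul_inv_cancel, Units.val_one]
  have hN₀ : ((reflexNormFiniteIdele F (Φ' 0) (reflexField F Φ ι₁) u : (FiniteAdeleRing (𝓞 F) F)ˣ) : FiniteAdeleRing (𝓞 F) F) =
      ((t : (FiniteAdeleRing (𝓞 F) F)ˣ) : FiniteAdeleRing (𝓞 F) F) := rfl
  have hN₁ : ((reflexNormFiniteIdele F (Φ' 1) (reflexField F Φ ι₁) u : (FiniteAdeleRing (𝓞 F) F)ˣ) : FiniteAdeleRing (𝓞 F) F) =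
      ((t : (FiniteAdeleRing (𝓞 F) F)ˣ) : FiniteAdeleRing (𝓞 F) F) *
        ratFiniteAdeleTensorEquiv F (finAdeleToTensor F (RingHom.id F)
          (recipFactor F (finiteIdeleRelNorm F ↥(reflexField F Φ ι₁) u))) := by
    rw [hΦ'1]
    exact reflexNormFiniteIdele_swap_recipFactor F (RingHom.id F) Φ Ψ (reflexField F Φ ι₁) ι₁ (fun x => rfl) hEΦ hΨE
      (fun ρ hρ => by rw [RingHom.comp_id] at hρ; rw [hρ]; exact hΦ) hΨ u
  have hr : ((auxToGspFinV Fr (d', t) : GL (Fin g ⊕ Fin g) finAdeleQ) : Matrix (Fin g ⊕ Fin g) (Fin g ⊕ Fin g) finAdeleQ) =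
      c.cmRecipMatrix Φ' (reflexField F Φ ι₁) u :=
    coe_auxToGspFinV_eq_cmRecipMatrix_of_isDiagTwistGS Fr b hb1' hperp c hact hd' t Φ' (reflexField F Φ ι₁) u hN₀ hN₁
  -- the scalar `ũ_V(1, t)` is central in the image torus: the SPLIT identity (it is NOT absorbed into any level here)
  have hsplit : auxToGspFinV Fr (d', t) * auxToGspFinV Fr (a, 1) = auxToGspFinV Fr (d' * a, 1) * auxToGspFinV Fr (1, t) := by
    rw [← map_mul, Prod.mk_mul_mk, mul_one, auxToGspFinV_eq_mul, auxToGspFinV_one_mul_comm_one]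
  -- the two twist classes on the curve agree (FILE D)
  have hGS : ∀ K : Subgroup ↥(finAdelic (↥(maximalRealSubfield F)) F (IsCMField.complexConj F) 2 Jstar),
      ShimuraSetGS.mk F Jstar ι₁ K (fun i => ι₁ (w i)) hw (d * a) = ShimuraSetGS.mk F Jstar ι₁ K (fun i => ι₁ (w i)) hw (d' * a) :=
    fun K => shimuraSetGS_mk_twist_eq_of_isArtinCorrespondent' F Jstar hJ ι₁ K hs hNu hww hw hd hd' a
  refine ⟨c, Φ', u, t, d', hsp, hpin, hΦ'0, hΨ', ?_, hus, hr, rfl,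
    ⟨finiteIdeleRelNorm F ↥(reflexField F Φ ι₁) u, hNu, hd', hN₁⟩, hsplit, hGS⟩
  intro i
  fin_cases i
  · exact hEΦ
  · exact hΨE

/-- **(S2a) FOR `F/ℚ` GALOIS — EVERY `σ ∈ Aut(ℂ/ι₁F)`**: the head `exists_siegelRecipDatum_centralTwist` with its hypothesis «`σ` fixes `E♯`»
discharged from «`σ` fixes `ι₁(F)`» (§1 `forall_mem_reflexField_apply_eq_of_isGalois`: both reflex fields of the special pair lie in the
Galois field `ι₁(F)`).  This is the shape the sheet line consumes (`γ̃ ∈ Aut(ℂ/ι₁F)` extending `γ ∈ Gal(Fᵢ/F)`).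
[cite: Milne2005ShimuraVarieties, Def. 12.8 (59)–(62) p. 114] [cite: Shimura1998, §8.3 Prop. 28, §18.6 p. 128] [cite: Liu2021, App. C Lem. C.14 (p. 113)] -/
theorem exists_siegelRecipDatum_centralTwist_of_isGalois [IsGalois ℚ F] (ι₁ : F →+* ℂ) (Jstar : Matrix (Fin 2) (Fin 2) F)
    (hJ : (Jstar.map (IsCMField.complexConj F))ᵀ = Jstar) (Φ : CMType F) (hΦ : ι₁ ∈ Φ.1) {ξ : F} {g : ℕ} {δ : Fin g → ℕ}
    (Fr : SymplecticFrameV F (RingHom.id F) Jstar ξ g δ)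
    (J : (Fin 2 → ℂ) → Matrix (Fin g ⊕ Fin g) (Fin g ⊕ Fin g) ℝ)
    (hJC : ∀ v : Fin 2 → ℂ, v ∈ negCone (Jstar.map ι₁) → J v ∈ C0pm δ)
    (hJsp : ∀ (w : Fin 2 → F) (hw : (fun i => ι₁ (w i)) ∈ negCone (Jstar.map ι₁)) (b : GL (Fin 2) F),
      (fun i => (b : Matrix (Fin 2) (Fin 2) F) i 1) = w →
      hermForm (cmConjRingHom F) Jstar (fun i => (b : Matrix (Fin 2) (Fin 2) F) i 0) w = 0 →
      ∀ c : CMStructure g δ (Fin 2) (fun _ => F),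
        (∀ (x : Fin 2 → F) (p : Fin 2) (m : F),
          c.act x (Fr.β (m • (b : Matrix (Fin 2) (Fin 2) F) *ᵥ Pi.single p 1)) =
            Fr.β ((x p * m) • (b : Matrix (Fin 2) (Fin 2) F) *ᵥ Pi.single p 1)) →
        ∀ Φ' : Fin 2 → CMType F, Φ' 0 = Φ →
          (∀ ρ : F →+* ℂ, ρ ∈ (Φ' 1).1 ↔ (ρ ∈ Φ.1 ∧ ρ ≠ ι₁) ∨ ρ = NumberField.ComplexEmbedding.conjugate ι₁) →
          c.IsSpecial ⟨J (fun i => ι₁ (w i)), hJC _ hw⟩ Φ') :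
    haveI : NumberField ↥(reflexField F Φ ι₁) := numberField_reflexField F Φ ι₁
    ∀ σ : ℂ ≃ₐ[ℚ] ℂ, (∀ x : F, σ (ι₁ x) = ι₁ x) →
      ∀ s : (FiniteAdeleRing (𝓞 F) F)ˣ, IsArtinCorrespondent F ι₁ s σ.toRingEquiv →
      ∀ (w : Fin 2 → F) (hw : (fun i => ι₁ (w i)) ∈ negCone (Jstar.map ι₁))
        (d : ↥(finAdelic (↥(maximalRealSubfield F)) F (IsCMField.complexConj F) 2 Jstar)),
        IsDiagTwistGS F Jstar w (recipFactor F s) d →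
      ∀ a : ↥(finAdelic (↥(maximalRealSubfield F)) F (IsCMField.complexConj F) 2 Jstar),
        ∃ (c : CMStructure g δ (Fin 2) (fun _ => F)) (Φ' : Fin 2 → CMType F)
          (sE : (FiniteAdeleRing (𝓞 ↥(reflexField F Φ ι₁)) ↥(reflexField F Φ ι₁))ˣ) (t : ↥(torusFinAdelic F))
          (d' : ↥(finAdelic (↥(maximalRealSubfield F)) F (IsCMField.complexConj F) 2 Jstar)),
          c.IsSpecial ⟨J (fun i => ι₁ (w i)), hJC _ hw⟩ Φ' ∧
          (∀ x : F, c.actMatrix (fun _ => x) = framePV Fr * resMatrix (ratBasis F) (x • (1 : Matrix (Fin 2) (Fin 2) F)) * frameQV Fr) ∧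
          Φ' 0 = Φ ∧ (∀ ρ : F →+* ℂ, ρ ∈ (Φ' 1).1 ↔ (ρ ∈ Φ.1 ∧ ρ ≠ ι₁) ∨ ρ = NumberField.ComplexEmbedding.conjugate ι₁) ∧
          (∀ i, traceField (Φ' i) ≤ reflexField F Φ ι₁) ∧ (∀ x : ℂ, x ∈ reflexField F Φ ι₁ → σ x = x) ∧
          IsArtinCorrespondent ↥(reflexField F Φ ι₁) (algebraMap ↥(reflexField F Φ ι₁) ℂ) sE σ.toRingEquiv ∧
          ((auxToGspFinV Fr (d', t) : GL (Fin g ⊕ Fin g) finAdeleQ) : Matrix (Fin g ⊕ Fin g) (Fin g ⊕ Fin g) finAdeleQ) =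
            c.cmRecipMatrix Φ' (reflexField F Φ ι₁) sE ∧
          (t : (FiniteAdeleRing (𝓞 F) F)ˣ) = reflexNormFiniteIdele F Φ (reflexField F Φ ι₁) sE ∧
          (∃ s' : (FiniteAdeleRing (𝓞 F) F)ˣ, IsArtinCorrespondent F ι₁ s' σ.toRingEquiv ∧ IsDiagTwistGS F Jstar w (recipFactor F s') d' ∧
            ((reflexNormFiniteIdele F (Φ' 1) (reflexField F Φ ι₁) sE : (FiniteAdeleRing (𝓞 F) F)ˣ) : FiniteAdeleRing (𝓞 F) F) =
              ((t : (FiniteAdeleRing (𝓞 F) F)ˣ) : FiniteAdeleRing (𝓞 F) F) *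
                ratFiniteAdeleTensorEquiv F (finAdeleToTensor F (RingHom.id F) (recipFactor F s'))) ∧
          auxToGspFinV Fr (d', t) * auxToGspFinV Fr (a, 1) = auxToGspFinV Fr (d' * a, 1) * auxToGspFinV Fr (1, t) ∧
          ∀ K : Subgroup ↥(finAdelic (↥(maximalRealSubfield F)) F (IsCMField.complexConj F) 2 Jstar),
            ShimuraSetGS.mk F Jstar ι₁ K (fun i => ι₁ (w i)) hw (d * a) = ShimuraSetGS.mk F Jstar ι₁ K (fun i => ι₁ (w i)) hw (d' * a) := by
  intro σ hσF s hs w hw d hd a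
  have hσ : ∀ x : ℂ, x ∈ reflexField F Φ ι₁ → σ x = x :=
    UnitaryCanonicalModel.Aux.forall_mem_reflexField_apply_eq_of_isGalois F Φ ι₁ σ hσF
  obtain ⟨c, Φ', sE, t, d', hsp, hpin, h0, h1, hE, hsE, hr, ht, hs', hsplit, hGS⟩ :=
    exists_siegelRecipDatum_centralTwist ι₁ Jstar hJ Φ hΦ Fr J hJC hJsp σ hσ s hs w hw d hd a
  exact ⟨c, Φ', sE, t, d', hsp, hpin, h0, h1, hE, hσ, hsE, hr, ht, hs', hsplit, hGS⟩

end AuxV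

end UnitaryCurve

end Literature.AlgebraicGeometry.ShimuraVarieties

end
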